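import Summits.QuantumFields.QCD.Theses.PauliWegnerSea
import Literature.MathematicalPhysics.QuantumFieldTheory.QCDPhaseQuenched
import Literature.MathematicalPhysics.QuantumLattice.GrassmannIntegralProofs

/-!
# Disproof of `FMClosureUnquenched` (stmt-QuantumFields-11512) — standing adversary file

Findings (cycle 1, refuter-cdisprove-stmt-QuantumFields-11512-0), indexed:

* §0 `pqMoment`, `OneScaleInput`, `Decay`, `Core`, `fmClosure_iff` — the crux is
  `FibreCofactorDomination → TiltedFlatness → Core`; the equivalence is definitional.
* §1 GUARD (refutation cost): `refutation_cost` — any Lean refutation `¬ FMClosureUnquenched`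
  must PROVE both guards K1 = `FibreCofactorDomination` and K3 = `TiltedFlatness` (and `¬ Core`);
  `of_not_guards` — conversely a refutation of K1 or K3 closes this crux ex falso (cheap `proved`).
  Paper sketch of `¬ TiltedFlatness (b)` in the docstring of `of_not_tiltedFlatness` (the planner's
  own two-branch worry made concrete: frustrated octahedral star couplings + a mass tuned to a real
  Wilson–Dirac eigenvalue); not Lean-closable here (Laplace asymptotics of a Haar integral).
* §2 DECORATION: `core_iff_coreAnyMass` — the hypothesis `∀ f, 0 < m f` carries no weight: the
  bare masses `mcrit k + a_k m_f / Zm k` absorb any real tuple by shifting the (unconstrained)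
  `mcrit`. All physics of `m > 0` must enter through the one-scale input.
* §3 DEGENERATE INSTANCE: `core_nf_zero` — at `N_f = 0` the conclusion is vacuous (true); no kill.
* §4 LOAD-BEARING / SOFT CORNER: `room_void_at_one`, `core_imp_nnCriterion` — at `ℓ₀ = 1` and
  `β_k = 0` the "room against every polynomial" `ℓ₀^q (1+|β_k|)^q` equals `1`, so `Core` CONTAINS
  the threshold-free nearest-neighbour criterion `NNCriterion`: for EVERY `N_f`, EVERY bare-mass
  sequence (via `mcrit`, `Zm` free) at strong coupling `β = 0`, "phase-quenched n.n. fractional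
  moment ≤ 1 uniformly in the volume ⇒ exponential decay at a physical rate `δ a_k`".
  The abstract surrogate `AbstractFMClosure` (moment functional replaced by an arbitrary kernel
  `0 ≤ E ≤ 1` with the same scheme side conditions) is FALSE: `not_abstractFMClosure`, witness
  `E ≡ 1/2`, `a_k = 1/(k+1)`, `L_k = (k+1)^2`, `β ≡ 0`, `ℓ₀ = 1`. Hence every proof of the crux
  must use structure of the Wilson–Dirac moment beyond boundedness, and at the corner it must
  derive decay from an `O(1)` (not small) one-step bound — which the Aizenman–Schenker–Friedrich–
  Hundertmark criterion does NOT do (it needs `b_s · |∂Λ| · ε < 1`).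
  WHY IT RESISTS NEVERTHELESS (numerics, §7): `∃ s ∈ (0,1), E[X^s] ≤ 1 ⇔ E log X < 0`
  (log-convexity of `s ↦ E X^s`), and the GEOMETRIC MEAN of the axis entry sum
  `X = Σ_{a i b j}|G(0,±e_μ)_{ai,bj}|` at criticality is `≥ 1.158 > 1` in every regime of the
  `β → 0` sea: `4.80 · (2κ_c)² · 4 ≈ 4.8` at strong coupling (`κ_c = 1/4`), decreasing to the
  fermion-induced near-free value `0.24144 × 4.7945 = 1.1576` (free massless `r = 1` block in the
  tree's chiral γ-basis × Haar geometric mean of `Σ_{ab}|g_{ab}|`). So the hypothesis of `NNCriterion`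
  fails exactly where decay fails: the corner is EMPTY — by a 16% margin that is pure luck of the
  γ-representation (were `γ_μ` diagonal, `0.1514 × 4.7945 = 0.726 < 1` and `Core` would be false on
  paper in the `N_f → ∞`, `β = 0`, `M_k → M_c` regime). REPAIR (costless for the assembly,
  `coreRepaired_of_core`): ask the shell with `2 ≤ ℓ₀` (or write the room as `(2ℓ₀)^q`), which
  restores genuine smallness `E ≤ 2^{-q}` for every `q` and removes the basis dependence.

* §5 INSIDE THE SHELL (rattack A6 formalised): `not_abstractFMClosureRepaired` — even with the
  repaired input (`2 ≤ ℓ₀`, infinite room, `E = 0` from the shell outward) and a radially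
  non-increasing kernel, the typed conclusion fails: it demands `E ≤ C a_k^{δK₀}` INSIDE the log-scale
  shell, which no outward bootstrap gives. Repair options listed there.
* §6 POSITIVE COUNTERPART: `outward_bootstrap` — the ASFH iteration certified abstractly on `ℤ⁴`;
  pins what AprioriBound + DecouplingLemma must deliver (local window count; one-step Harnack transfer,
  since ASFH Thm 11 consumes an annulus / two shells while the input gives one).
* §8 NON-VACUITY (cycle 2): `oneScaleInput_nonvacuous` — the heavy strong-coupling sea `reg₀`
  (`β ≡ 0`, `m_crit ≡ 250`) satisfies `OneScaleInput` in the tree's own objects, through the unit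
  shell `ℓ₀ = 1` for every `q` (max-principle entry bound `norm_inv_entry_le_of_rowsum` for
  diagonally dominant inverses + Wilson hopping row sums `≤ 96` + Bochner monotonicity against the
  `|det|` weight); `decay_reg₀_of_core`: what the crux then claims for this sea.
* §9 TARGETS (comment block at the end): the five open stubs of the picked line
  `thick-collar-far-stability` attacked cheaply — 0 broken (unit-shell seam margin +0.115 at m = 0.1
  even in the large-N_f pure-gauge regime; heavy sea is no counterexample to `stub_inward`; (T5) corners
  β → ±∞ absorbed by the polynomial allowance).
* §7 NUMBERS behind §4 (comment block at the end): free massless Wilson n.n. block, Haar `SU(3)`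
  entry sums, strong-coupling leading order, the 16% margin and its basis dependence; scripts
  `num/axis_massless.py`, `num/corner_pure.py`, `haar_log.py` in the seat folder (kit job j005128 =
  the same computation, queued > 6 h on a saturated farm; local pure-python run instead).

No `sorry` in this file except where marked NEAR-MISS (none at cycle 1).
-/

namespace Summit.QuantumFields.QCD.Cruxes.FMClosureUnquenched.Disproof

open Summit.QuantumFields.QCD.Theses.PauliWegnerSea
open MeasureTheory Filter Topology
open Literature.MathematicalPhysics.QuantumFieldTheory Literature.MathematicalPhysics.QuantumLattice
  Literature.Probability.LatticeModels

local notation "𝔾" => Matrix.specialUnitaryGroup (Fin 3) ℂ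

noncomputable section

/-! ## §0 The crux unbundled -/

/-- The phase-quenched fractional moment `E_{|w|,k,S}[(Σ_{a,i,b,j} |G_f(0,v)_{ai,bj}|)^s]`
of the crux, verbatim (ratio of Bochner integrals against `wilsonMeasure` at `β_k` on the torus of
side `2S+1`, weight `‖det diracMatrix‖` at the bare masses `mcrit k + a_k m_f / Zm k`). -/
def pqMoment {Nf : ℕ} (reg : QCDRegularisation Nf) (m : Fin Nf → ℝ) (k S : ℕ) (f : Fin Nf)
    (v : Literature.Probability.LatticeModels.Site 4) (s : ℝ) : ℝ :=
  (∫ U : GaugeConfig 4 (2 * S + 1) 𝔾,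
      ‖(diracMatrix U fun fl => reg.mcrit k + reg.a k * m fl / reg.Zm k).det‖ *
        (∑ a : Fin 3, ∑ i : Fin 4, ∑ b : Fin 3, ∑ j : Fin 4,
          ‖(diracMatrix U fun fl => reg.mcrit k + reg.a k * m fl / reg.Zm k)⁻¹
            (quarkEquiv (f, (Torus.proj (2 * S + 1) 0, a, i)))
            (quarkEquiv (f, (Torus.proj (2 * S + 1) v, b, j)))‖) ^ s
      ∂(wilsonMeasure (fundamentalRep (Fin 3)) (reg.β k))) /
    (∫ U : GaugeConfig 4 (2 * S + 1) 𝔾,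
      ‖(diracMatrix U fun fl => reg.mcrit k + reg.a k * m fl / reg.Zm k).det‖
      ∂(wilsonMeasure (fundamentalRep (Fin 3)) (reg.β k)))

/-- The ONE-SCALE INPUT of the crux (hypothesis), verbatim over `pqMoment`. -/
def OneScaleInput {Nf : ℕ} (reg : QCDRegularisation Nf) (m : Fin Nf → ℝ) : Prop :=
  ∀ q : ℕ, ∃ K₀ s : ℝ, 0 < s ∧ s < 1 ∧ ∀ᶠ k in atTop, ∃ ℓ₀ : ℕ, 1 ≤ ℓ₀ ∧ ℓ₀ ≤ reg.L k ∧
    (ℓ₀ : ℝ) * reg.a k ≤ K₀ * (1 + |Real.log (reg.a k)|) ∧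
    ∀ S : ℕ, reg.L k ≤ S → ∀ (f : Fin Nf) (v : Literature.Probability.LatticeModels.Site 4),
      v ∈ box 4 S → ‖v‖ = (ℓ₀ : ℝ) →
        (ℓ₀ : ℝ) ^ q * (1 + |reg.β k|) ^ q * pqMoment reg m k S f v s ≤ 1

/-- The CONCLUSION of the crux (= clause (ii) of `WilsonMobilityGap.MobilityGap`), verbatim. -/
def Decay {Nf : ℕ} (reg : QCDRegularisation Nf) (m : Fin Nf → ℝ) : Prop :=
  ∃ s δ C : ℝ, 0 < s ∧ s < 1 ∧ 0 < δ ∧ ∀ᶠ k in atTop, ∀ S : ℕ, reg.L k ≤ S →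
    ∀ (f : Fin Nf) (v : Literature.Probability.LatticeModels.Site 4), v ∈ box 4 S →
      pqMoment reg m k S f v s ≤ C * Real.exp (-(δ * (reg.a k * ‖v‖)))

/-- The unguarded core of the crux: the fractional-moment finite-volume criterion itself. -/
def Core : Prop :=
  ∀ (Nf : ℕ) (reg : QCDRegularisation Nf) (m : Fin Nf → ℝ), (∀ f, 0 < m f) →
    OneScaleInput reg m → Decay reg m

/-- The crux is literally `K1 → K3 → Core` (definitional unfolding). -/
theorem fmClosure_iff :
    FMClosureUnquenched ↔ (FibreCofactorDomination → TiltedFlatness → Core) :=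
  Iff.rfl

/-! ## §1 The guard: what a refutation costs, and the ex-falso closure -/

/-- REFUTATION COST. A Lean refutation of the crux as filed must contain proofs of BOTH guards
(the rank-2 and rank-3 cruxes of the route) together with a refutation of the core. -/
theorem refutation_cost (h : ¬ FMClosureUnquenched) :
    FibreCofactorDomination ∧ TiltedFlatness ∧ ¬ Core := by
  rw [fmClosure_iff] at h
  by_cases h1 : FibreCofactorDomination
  · by_cases h3 : TiltedFlatness
    · exact ⟨h1, h3, fun hc => h fun _ _ => hc⟩
    · exact absurd (fun _ h3' => absurd h3' h3) h
  · exact absurd (fun h1' _ => absurd h1' h1) h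

/-- EX-FALSO CLOSURE. If either guard is refuted, this crux is (cheaply) PROVED. -/
theorem of_not_guards (h : ¬ (FibreCofactorDomination ∧ TiltedFlatness)) : FMClosureUnquenched :=
  fmClosure_iff.2 fun h1 h3 => absurd ⟨h1, h3⟩ h

/-- In particular a refutation of `TiltedFlatness` proves this crux. PAPER SKETCH of
`¬ TiltedFlatness` (clause (b), uniformity in `β`), recorded for the K3 seats — not closable in Lean
here (it needs Laplace asymptotics `β → ∞` of a 16-link Haar integral):
take `x`, `y` far apart; the fibre action of `star(x)` given the outside `U` is the `SU(3)` "spin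
glass" `W ↦ -Σ_{a,b} Re tr (W_a J_{ab} W_b†)` on the octahedral graph `K_{2,2,2,2}` of the 8 star
links (one plaquette per non-antipodal pair, 24 plaquettes), whose couplings `J_{ab} ∈ SU(3)` are
products of two OUTSIDE links, disjoint for distinct plaquettes — hence freely prescribable.
Choose them frustrated (a centre flux `ω·1` through the triangles) with a discrete symmetry not in
the gauge group, so that the minimiser set has two gauge-inequivalent branches `Σ₁`, `Σ₂` of equal
depth and curvature. `det D_W(refit W)` is gauge invariant, hence constant on each branch; tune one
mass `m₁ ∈ [-2,2]` onto a real eigenvalue of `D_W(refit W⁽¹⁾; 0)` in `[-2,2]` (real modes exist for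
rough fields) so that `F ≡ 0` on `Σ₁`, `F ≢ 0` on `Σ₂`. Then as `β → ∞` the tilted law splits its
mass `θ₁ + θ₂ = 1`, `M → θ₂ F(Σ₂) > 0`, while near `Σ₁`, `F = O(β^{-1/2})`: the law of `F/M`
acquires an atom of mass `θ₁` at `0`, i.e. `ν(F ≤ ε M) → θ₁` for every fixed `ε > 0`,
contradicting `≤ C ε^c` uniformly in `β`. (Clause (a) is not threatened by this construction.) -/
theorem of_not_tiltedFlatness (h : ¬ TiltedFlatness) : FMClosureUnquenched :=
  of_not_guards fun hg => h hg.2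

/-- … and likewise a refutation of `FibreCofactorDomination`. -/
theorem of_not_fibreCofactorDomination (h : ¬ FibreCofactorDomination) : FMClosureUnquenched :=
  of_not_guards fun hg => h hg.1

/-! ### Remark for the K1 seats (guard solidity): no Aharonov–Bohm cages for `r = 1` Wilson–Dirac

The route's own cheap kill of K1 ("det ≡ 0 on a two-star fibre via a compactly supported zero
mode") cannot occur. PAPER LEMMA (any gauge group, any background, any `m`, eigenvalue `λ`): if
`(D_W - λ)φ = 0` with `r = 1` and `supp φ` misses, in every direction `μ`, two adjacent hyperplane
slices `{x_μ = t_μ}, {x_μ = t_μ + 1}` of the torus (e.g. `φ` compactly supported in `ℤ⁴`), then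
`φ = 0`. Proof: the hops are `-(P∓^μ ⊗ U)` with COMPLEMENTARY spin projectors `P±^μ = (1 ± γ_μ)/2`;
at an exterior site `w` adjacent to the support the equation `(Dφ)(w) = 0` splits over the direct sum
`Range P₊^μ ⊕ Range P₋^μ`, and `Range P₊^μ ∩ Range P₊^ν = 0` for `μ ≠ ν` (anticommutation). Take
`x ∈ supp φ` maximising a generic functional `Σ c_ν x̃_ν` (`x̃_ν` = height above the empty slab,
`c_μ > c_{μ₂} > …`): reading the equation at `w = x + e_μ` gives `P₊^μ φ(x) = 0`, at
`w' = x + e_{μ₂}` gives `P₊^{μ₂} φ(x) = 0` (the only other possibly supported neighbour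
`x + e_{μ₂} - e_μ` enters through `P₊^μ`, a range in direct sum with `Range P₊^{μ₂}`), hence
`γ_μ φ(x) = γ_{μ₂} φ(x) = -φ(x)`, so `{γ_μ, γ_{μ₂}} φ(x) = 2φ(x) = 0` — contradiction. Consequence for
K1: a kernel vector of `D(refit W')` common to the whole two-star fibre must wrap the torus (slab
modes; an overdetermined `12L³`-codimension condition), and where the kernel is simple it vanishes at
`x, y`, forcing `adj_{xy} = 0` (γ₅-hermiticity), consistent with K1. So K1 is not cheaply false,
and this crux is not cheaply true through `of_not_fibreCofactorDomination`. -/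

/-! ## §2 Decoration: positivity of the renormalised masses is never used -/

/-- `Core` with the hypothesis `∀ f, 0 < m f` dropped. -/
def CoreAnyMass : Prop :=
  ∀ (Nf : ℕ) (reg : QCDRegularisation Nf) (m : Fin Nf → ℝ), OneScaleInput reg m → Decay reg m

/-- Shifting the flavour-blind critical mass: the regularisation with
`mcrit' k = mcrit k - a_k c / Zm k`. -/
def shiftReg {Nf : ℕ} (reg : QCDRegularisation Nf) (c : ℝ) : QCDRegularisation Nf where
  a := reg.a
  a_pos := reg.a_pos
  tendsto_a := reg.tendsto_a
  β := reg.β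
  L := reg.L
  tendsto_L := reg.tendsto_L
  mcrit := fun k => reg.mcrit k - reg.a k * c / reg.Zm k
  Zm := reg.Zm
  Zm_pos := reg.Zm_pos

theorem shiftReg_bareMass {Nf : ℕ} (reg : QCDRegularisation Nf) (c : ℝ) (m : Fin Nf → ℝ) (k : ℕ) :
    (fun fl => (shiftReg reg c).mcrit k + (shiftReg reg c).a k * (m fl + c) / (shiftReg reg c).Zm k)
      = fun fl => reg.mcrit k + reg.a k * m fl / reg.Zm k := by
  funext fl
  have hZ : reg.Zm k ≠ 0 := (reg.Zm_pos k).ne'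
  simp only [shiftReg]
  field_simp
  ring

theorem pqMoment_shiftReg {Nf : ℕ} (reg : QCDRegularisation Nf) (c : ℝ) (m : Fin Nf → ℝ)
    (k S : ℕ) (f : Fin Nf) (v : Literature.Probability.LatticeModels.Site 4) (s : ℝ) :
    pqMoment (shiftReg reg c) (fun fl => m fl + c) k S f v s = pqMoment reg m k S f v s := by
  unfold pqMoment
  rw [shiftReg_bareMass]
  rfl

theorem oneScaleInput_shiftReg {Nf : ℕ} (reg : QCDRegularisation Nf) (c : ℝ) (m : Fin Nf → ℝ) :
    OneScaleInput (shiftReg reg c) (fun fl => m fl + c) ↔ OneScaleInput reg m := by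
  unfold OneScaleInput
  simp only [pqMoment_shiftReg]
  rfl

theorem decay_shiftReg {Nf : ℕ} (reg : QCDRegularisation Nf) (c : ℝ) (m : Fin Nf → ℝ) :
    Decay (shiftReg reg c) (fun fl => m fl + c) ↔ Decay reg m := by
  unfold Decay
  simp only [pqMoment_shiftReg]
  rfl

/-- DECORATION: the mass-positivity hypothesis of the crux is idle — `Core ↔ CoreAnyMass`.
(Any real tuple `m` is realised with the positive tuple `m + c`, `c = 1 + Σ|m_f|`, by the shifted
regularisation; `mcrit` is unconstrained data of `QCDRegularisation`.) -/
theorem core_iff_coreAnyMass : Core ↔ CoreAnyMass := by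
  constructor
  · intro h Nf reg m hin
    set c : ℝ := 1 + ∑ f, |m f| with hc
    have hpos : ∀ f, 0 < m f + c := by
      intro f
      have h1 : |m f| ≤ ∑ g, |m g| :=
        Finset.single_le_sum (f := fun g => |m g|) (fun _ _ => abs_nonneg _) (Finset.mem_univ f)
      have h2 : -|m f| ≤ m f := neg_abs_le _
      rw [hc]; linarith
    have := h Nf (shiftReg reg c) (fun fl => m fl + c) hpos
      ((oneScaleInput_shiftReg reg c m).2 hin)
    exact (decay_shiftReg reg c m).1 this
  · intro h Nf reg m _ hin
    exact h Nf reg m hin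

/-! ## §3 Degenerate instance `N_f = 0`: true, no kill -/

/-- With no flavours the conclusion quantifies over `Fin 0`: `Core` holds at `N_f = 0`. -/
theorem core_nf_zero (reg : QCDRegularisation 0) (m : Fin 0 → ℝ) : Decay reg m :=
  ⟨1 / 2, 1, 0, by norm_num, by norm_num, one_pos,
    Eventually.of_forall fun _ _ _ f => f.elim0⟩

/-! ## §4 The soft corner `ℓ₀ = 1`, `β_k → 0`: the polynomial room is void -/

/-- At `ℓ₀ = 1`, `β = 0` the room factor of the one-scale input is `1` for every `q`. -/
theorem room_void_at_one (q : ℕ) : (((1 : ℕ) : ℝ)) ^ q * (1 + |(0 : ℝ)|) ^ q = 1 := by simp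

/-- The THRESHOLD-FREE NEAREST-NEIGHBOUR CRITERION hidden in the crux: at `β ≡ 0`, for every
`N_f` and every bare-mass sequence, a volume-uniform bound `≤ 1` on the phase-quenched fractional
moment at the 80 sup-norm neighbours of the origin implies exponential decay at a physical rate. -/
def NNCriterion : Prop :=
  ∀ (Nf : ℕ) (reg : QCDRegularisation Nf), (∀ k, reg.β k = 0) → ∀ m : Fin Nf → ℝ, (∀ f, 0 < m f) →
    (∃ s : ℝ, 0 < s ∧ s < 1 ∧ ∀ᶠ k in atTop, ∀ S : ℕ, reg.L k ≤ S →
      ∀ (f : Fin Nf) (v : Literature.Probability.LatticeModels.Site 4), v ∈ box 4 S → ‖v‖ = 1 →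
        pqMoment reg m k S f v s ≤ 1) →
    Decay reg m

/-- Eventually `a_k ≤ 1` and `1 ≤ L_k` for every regularisation. -/
theorem eventually_a_le_one_and_one_le_L {Nf : ℕ} (reg : QCDRegularisation Nf) :
    ∀ᶠ k in atTop, reg.a k ≤ 1 ∧ 1 ≤ reg.L k := by
  have ha : ∀ᶠ k in atTop, reg.a k ≤ 1 :=
    (reg.tendsto_a.eventually (gt_mem_nhds one_pos)).mono fun k hk => hk.le
  have hL : ∀ᶠ k in atTop, 1 ≤ reg.L k := by
    have h1 : ∀ᶠ k in atTop, (1 : ℝ) ≤ reg.a k * reg.L k := reg.tendsto_L.eventually_ge_atTop 1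
    filter_upwards [h1, ha] with k hk hak
    by_contra hcon
    push Not at hcon
    have : reg.L k = 0 := by omega
    rw [this] at hk
    simp at hk
    linarith
  exact ha.and hL

/-- SOFT CORNER. `Core` implies the threshold-free nearest-neighbour criterion: the one-scale
input is witnessed by `ℓ₀ = 1`, `K₀ = 1` for every `q` at once (room factor `1^q · 1^q = 1`). -/
theorem core_imp_nnCriterion (h : Core) : NNCriterion := by
  intro Nf reg hβ m hm hnn
  obtain ⟨s, hs0, hs1, hev⟩ := hnn
  refine h Nf reg m hm fun q => ⟨1, s, hs0, hs1, ?_⟩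
  filter_upwards [hev, eventually_a_le_one_and_one_le_L reg] with k hk hk'
  refine ⟨1, le_rfl, hk'.2, ?_, ?_⟩
  · have : 0 ≤ |Real.log (reg.a k)| := abs_nonneg _
    push_cast
    nlinarith [hk'.1]
  · intro S hS f v hv hnorm
    have := hk S hS f v hv (by simpa using hnorm)
    simpa [hβ k] using this

/-! ### The abstract surrogate is false: boundedness of the moment is not enough -/

/-- One-scale input over an ABSTRACT moment kernel `E k S v s` (flavour dropped). -/
def AbsInput (a β : ℕ → ℝ) (L : ℕ → ℕ)
    (E : ℕ → ℕ → Literature.Probability.LatticeModels.Site 4 → ℝ → ℝ) : Prop :=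
  ∀ q : ℕ, ∃ K₀ s : ℝ, 0 < s ∧ s < 1 ∧ ∀ᶠ k in atTop, ∃ ℓ₀ : ℕ, 1 ≤ ℓ₀ ∧ ℓ₀ ≤ L k ∧
    (ℓ₀ : ℝ) * a k ≤ K₀ * (1 + |Real.log (a k)|) ∧
    ∀ S : ℕ, L k ≤ S → ∀ v : Literature.Probability.LatticeModels.Site 4, v ∈ box 4 S →
      ‖v‖ = (ℓ₀ : ℝ) → (ℓ₀ : ℝ) ^ q * (1 + |β k|) ^ q * E k S v s ≤ 1

/-- Decay over an abstract moment kernel. -/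
def AbsDecay (a : ℕ → ℝ) (L : ℕ → ℕ)
    (E : ℕ → ℕ → Literature.Probability.LatticeModels.Site 4 → ℝ → ℝ) : Prop :=
  ∃ s δ C : ℝ, 0 < s ∧ s < 1 ∧ 0 < δ ∧ ∀ᶠ k in atTop, ∀ S : ℕ, L k ≤ S →
    ∀ v : Literature.Probability.LatticeModels.Site 4, v ∈ box 4 S →
      E k S v s ≤ C * Real.exp (-(δ * (a k * ‖v‖)))

/-- The ABSTRACT finite-volume criterion: the crux's implication for an arbitrary kernel
`0 ≤ E ≤ 1` under the side conditions of `QCDRegularisation` (`a_k > 0`, `a_k → 0`,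
`a_k L_k → ∞`). -/
def AbstractFMClosure : Prop :=
  ∀ (a β : ℕ → ℝ) (L : ℕ → ℕ) (E : ℕ → ℕ → Literature.Probability.LatticeModels.Site 4 → ℝ → ℝ),
    (∀ k, 0 < a k) → Tendsto a atTop (𝓝 0) → Tendsto (fun k => a k * L k) atTop atTop →
    (∀ k S v s, 0 ≤ E k S v s ∧ E k S v s ≤ 1) → AbsInput a β L E → AbsDecay a L E

/-- The sup norm of the constant site `(n, n, n, n)` is `n`. -/
theorem norm_constSite (n : ℕ) :
    ‖(fun _ : Fin 4 => (n : ℤ) : Literature.Probability.LatticeModels.Site 4)‖ = n := by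
  rw [pi_norm_const]
  simp

/-- LOAD-BEARING: `¬ AbstractFMClosure`. Witness `a_k = 1/(k+1)`, `β ≡ 0`, `L_k = (k+1)²`,
`E ≡ 1/2`: the input holds with `ℓ₀ = 1`, `K₀ = 1` for every `q` (room factor `1`), while
`1/2 ≤ C e^{-δ a_k ‖v‖}` fails at `v = (n,n,n,n)`, `n → ∞` (volumes are unbounded above).
So any proof of the crux must use properties of `pqMoment` beyond `0 ≤ · ≤ 1`; at the corner
`ℓ₀ = 1` it must turn an `O(1)` one-step bound into decay. -/
theorem not_abstractFMClosure : ¬ AbstractFMClosure := by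
  intro h
  have ha_pos : ∀ k : ℕ, (0 : ℝ) < 1 / ((k : ℝ) + 1) := fun k => by positivity
  have ha_lim : Tendsto (fun k : ℕ => (1 : ℝ) / ((k : ℝ) + 1)) atTop (𝓝 0) :=
    tendsto_one_div_add_atTop_nhds_zero_nat
  have haL : Tendsto (fun k : ℕ => (1 : ℝ) / ((k : ℝ) + 1) * (((k + 1) ^ 2 : ℕ) : ℝ)) atTop atTop := by
    have : (fun k : ℕ => (1 : ℝ) / ((k : ℝ) + 1) * (((k + 1) ^ 2 : ℕ) : ℝ)) = fun k : ℕ => (k : ℝ) + 1 := by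
      funext k
      push_cast
      have : (k : ℝ) + 1 ≠ 0 := by positivity
      field_simp
    rw [this]
    exact tendsto_atTop_add_const_right _ 1 tendsto_natCast_atTop_atTop
  have hE : ∀ (k S : ℕ) (v : Literature.Probability.LatticeModels.Site 4) (s : ℝ),
      (0 : ℝ) ≤ 1 / 2 ∧ (1 / 2 : ℝ) ≤ 1 := fun _ _ _ _ => by norm_num
  have hin : AbsInput (fun k => 1 / ((k : ℝ) + 1)) (fun _ => 0) (fun k => (k + 1) ^ 2)
      (fun _ _ _ _ => 1 / 2) := by
    intro q
    refine ⟨1, 1 / 2, by norm_num, by norm_num, Eventually.of_forall fun k => ⟨1, le_rfl, ?_, ?_, ?_⟩⟩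
    · exact Nat.one_le_pow _ _ (Nat.succ_pos k)
    · have h0 : 0 ≤ |Real.log (1 / ((k : ℝ) + 1))| := abs_nonneg _
      have h1 : 1 / ((k : ℝ) + 1) ≤ 1 := by
        rw [div_le_one (by positivity)]
        linarith [(Nat.cast_nonneg k : (0 : ℝ) ≤ k)]
      push_cast
      nlinarith
    · intro S _ v _ _
      norm_num
  obtain ⟨s, δ, C, _, _, hδ, hev⟩ := h _ _ _ _ ha_pos ha_lim haL hE hin
  obtain ⟨k, hk⟩ := hev.exists
  -- choose a volume n ≥ L_k so large that C e^{-δ a_k n} < 1/2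
  obtain ⟨n, hn⟩ := exists_nat_gt (max (((k + 1) ^ 2 : ℕ) : ℝ) (2 * |C| * ((k : ℝ) + 1) / δ))
  have hn1 : (((k + 1) ^ 2 : ℕ) : ℝ) < n := lt_of_le_of_lt (le_max_left _ _) hn
  have hn2 : 2 * |C| * ((k : ℝ) + 1) / δ < n := lt_of_le_of_lt (le_max_right _ _) hn
  have hnL : (k + 1) ^ 2 ≤ n := by exact_mod_cast hn1.le
  have hv : (fun _ : Fin 4 => (n : ℤ)) ∈ box 4 n := by
    rw [mem_box]; intro i; constructor <;> simp
  have key := hk n hnL (fun _ => (n : ℤ)) hv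
  rw [norm_constSite] at key
  -- key : 1/2 ≤ C * exp (-(δ * (1/(k+1) * n)))
  have hk1 : (0 : ℝ) < (k : ℝ) + 1 := by positivity
  have hnpos : (0 : ℝ) < n := lt_of_le_of_lt (by positivity) hn1
  have hx : 0 < δ * (1 / ((k : ℝ) + 1) * n) := by positivity
  have hexp : Real.exp (-(δ * (1 / ((k : ℝ) + 1) * n))) ≤ 1 / (1 + δ * (1 / ((k : ℝ) + 1) * n)) := by
    have h1X : (0 : ℝ) < 1 + δ * (1 / ((k : ℝ) + 1) * n) := by positivity
    have h2X : 1 + δ * (1 / ((k : ℝ) + 1) * n) ≤ Real.exp (δ * (1 / ((k : ℝ) + 1) * n)) := by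
      linarith [Real.add_one_le_exp (δ * (1 / ((k : ℝ) + 1) * n))]
    rw [Real.exp_neg, ← one_div]
    exact one_div_le_one_div_of_le h1X h2X
  have hC : C * Real.exp (-(δ * (1 / ((k : ℝ) + 1) * n))) ≤
      |C| * (1 / (1 + δ * (1 / ((k : ℝ) + 1) * n))) :=
    (le_abs_self _).trans (by
      rw [abs_mul, abs_of_pos (Real.exp_pos _)]
      exact mul_le_mul_of_nonneg_left hexp (abs_nonneg C))
  have hX : 2 * |C| < δ * (1 / ((k : ℝ) + 1) * n) := by
    rw [div_lt_iff₀ hδ] at hn2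
    rw [show δ * (1 / ((k : ℝ) + 1) * n) = n * δ / ((k : ℝ) + 1) by ring, lt_div_iff₀ hk1]
    linarith
  have hlt : |C| * (1 / (1 + δ * (1 / ((k : ℝ) + 1) * n))) < 1 / 2 := by
    rw [mul_one_div, div_lt_iff₀ (by positivity)]
    linarith
  have : (1 / 2 : ℝ) ≤ C * Real.exp (-(δ * (1 / ((k : ℝ) + 1) * n))) := key
  linarith

/-! ### The repaired input and why the repair is free -/

/-- REPAIRED one-scale input: the shell radius is at least `2`, so `ℓ₀^q ≥ 2^q` is genuine room. -/
def OneScaleInputRepaired {Nf : ℕ} (reg : QCDRegularisation Nf) (m : Fin Nf → ℝ) : Prop :=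
  ∀ q : ℕ, ∃ K₀ s : ℝ, 0 < s ∧ s < 1 ∧ ∀ᶠ k in atTop, ∃ ℓ₀ : ℕ, 2 ≤ ℓ₀ ∧ ℓ₀ ≤ reg.L k ∧
    (ℓ₀ : ℝ) * reg.a k ≤ K₀ * (1 + |Real.log (reg.a k)|) ∧
    ∀ S : ℕ, reg.L k ≤ S → ∀ (f : Fin Nf) (v : Literature.Probability.LatticeModels.Site 4),
      v ∈ box 4 S → ‖v‖ = (ℓ₀ : ℝ) →
        (ℓ₀ : ℝ) ^ q * (1 + |reg.β k|) ^ q * pqMoment reg m k S f v s ≤ 1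

/-- `Core` with the repaired input. -/
def CoreRepaired : Prop :=
  ∀ (Nf : ℕ) (reg : QCDRegularisation Nf) (m : Fin Nf → ℝ), (∀ f, 0 < m f) →
    OneScaleInputRepaired reg m → Decay reg m

theorem oneScaleInput_of_repaired {Nf : ℕ} (reg : QCDRegularisation Nf) (m : Fin Nf → ℝ)
    (h : OneScaleInputRepaired reg m) : OneScaleInput reg m := by
  intro q
  obtain ⟨K₀, s, hs0, hs1, hev⟩ := h q
  refine ⟨K₀, s, hs0, hs1, hev.mono fun k ⟨ℓ₀, h2, hL, ha, hsh⟩ => ⟨ℓ₀, by omega, hL, ha, hsh⟩⟩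

/-- The repair is FREE for the assembly: the filed `Core` implies the repaired one (and the
trajectory item only ever supplies log-scale shells `ℓ₀ → ∞`). -/
theorem coreRepaired_of_core (h : Core) : CoreRepaired :=
  fun Nf reg m hm hin => h Nf reg m hm (oneScaleInput_of_repaired reg m hin)

/-- In the repaired input genuine smallness is forced: on the witnessing shell the moment is at
most `2^{-q}`. -/
theorem smallness_of_repaired {Nf : ℕ} (reg : QCDRegularisation Nf) (m : Fin Nf → ℝ)
    (h : OneScaleInputRepaired reg m) (q : ℕ) :
    ∃ s : ℝ, 0 < s ∧ s < 1 ∧ ∀ᶠ k in atTop, ∃ ℓ₀ : ℕ, 2 ≤ ℓ₀ ∧ ℓ₀ ≤ reg.L k ∧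
      ∀ S : ℕ, reg.L k ≤ S → ∀ (f : Fin Nf) (v : Literature.Probability.LatticeModels.Site 4),
        v ∈ box 4 S → ‖v‖ = (ℓ₀ : ℝ) → pqMoment reg m k S f v s ≤ (1 / 2) ^ q := by
  obtain ⟨K₀, s, hs0, hs1, hev⟩ := h q
  refine ⟨s, hs0, hs1, hev.mono fun k ⟨ℓ₀, h2, hL, _, hsh⟩ => ⟨ℓ₀, h2, hL, fun S hS f v hv hn => ?_⟩⟩
  have key := hsh S hS f v hv hn
  have hℓ : (2 : ℝ) ^ q ≤ (ℓ₀ : ℝ) ^ q := by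
    exact pow_le_pow_left₀ (by norm_num) (by exact_mod_cast h2) q
  have hβ : (1 : ℝ) ≤ (1 + |reg.β k|) ^ q := one_le_pow₀ (by linarith [abs_nonneg (reg.β k)])
  by_cases hp : pqMoment reg m k S f v s ≤ 0
  · exact hp.trans (by positivity)
  · push Not at hp
    have h2q : (0 : ℝ) < 2 ^ q := by positivity
    rw [show ((1 : ℝ) / 2) ^ q = 1 / 2 ^ q by rw [div_pow, one_pow], le_div_iff₀ h2q]
    calc pqMoment reg m k S f v s * 2 ^ q ≤ pqMoment reg m k S f v s * ((ℓ₀ : ℝ) ^ q * (1 + |reg.β k|) ^ q) := by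
          apply mul_le_mul_of_nonneg_left _ hp.le
          calc (2 : ℝ) ^ q ≤ (ℓ₀ : ℝ) ^ q := hℓ
            _ = (ℓ₀ : ℝ) ^ q * 1 := (mul_one _).symm
            _ ≤ (ℓ₀ : ℝ) ^ q * (1 + |reg.β k|) ^ q := by
                apply mul_le_mul_of_nonneg_left hβ (by positivity)
      _ = (ℓ₀ : ℝ) ^ q * (1 + |reg.β k|) ^ q * pqMoment reg m k S f v s := by ring
      _ ≤ 1 := key


/-! ## §5 Inside the shell: the typed conclusion asks for smallness no outward bootstrap gives

(A6 of the rattack seat, formalised.) The conclusion `Decay` is quantified over ALL `v ∈ box S`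
with a `k`-uniform prefactor `C`. When the input's witnessing shell sits at the log scale
`ℓ₀ ≈ K₀ |log a_k| / a_k` (the only place `OneScaleTrajectory` can plausibly supply it), the typed
bound at `‖v‖ = ℓ₀ - 1` reads `E ≤ C a_k^{δ K₀}` — genuine smallness INSIDE the shell, where the
input says nothing and the Aizenman–Schenker–Friedrich–Hundertmark bootstrap (which propagates
smallness OUTWARD, `E(v) ≤ A · b^{⌊‖v‖/ℓ₀⌋}`) only offers the a-priori bound `A`. The witness below
is the best conceivable bootstrap output — identically `0` from the shell outward — with a flat
core `1/2` inside, radially non-increasing, satisfying the REPAIRED input (`2 ≤ ℓ₀`, infinite room);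
it violates `Decay`. Hence any proof of the crux must ALSO win smallness inside the log-shell (e.g.
log-convexity / a spectral representation of `v ↦ pqMoment … v`, unknown for fractional moments), or
the conclusion must be weakened (prefactor `C a_k^{-p}`, or decay only for `‖v‖ ≥ ℓ₀(k)`), with the
consumers stmt-9151/9152 re-asked accordingly. -/

/-- Repaired abstract input (`2 ≤ ℓ₀`). -/
def AbsInputRepaired (a β : ℕ → ℝ) (L : ℕ → ℕ)
    (E : ℕ → ℕ → Literature.Probability.LatticeModels.Site 4 → ℝ → ℝ) : Prop :=
  ∀ q : ℕ, ∃ K₀ s : ℝ, 0 < s ∧ s < 1 ∧ ∀ᶠ k in atTop, ∃ ℓ₀ : ℕ, 2 ≤ ℓ₀ ∧ ℓ₀ ≤ L k ∧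
    (ℓ₀ : ℝ) * a k ≤ K₀ * (1 + |Real.log (a k)|) ∧
    ∀ S : ℕ, L k ≤ S → ∀ v : Literature.Probability.LatticeModels.Site 4, v ∈ box 4 S →
      ‖v‖ = (ℓ₀ : ℝ) → (ℓ₀ : ℝ) ^ q * (1 + |β k|) ^ q * E k S v s ≤ 1

/-- The abstract criterion with the repaired input AND a radially non-increasing kernel
`0 ≤ E ≤ 1` (no upward cliffs). -/
def AbstractFMClosureRepaired : Prop :=
  ∀ (a β : ℕ → ℝ) (L : ℕ → ℕ) (E : ℕ → ℕ → Literature.Probability.LatticeModels.Site 4 → ℝ → ℝ),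
    (∀ k, 0 < a k) → Tendsto a atTop (𝓝 0) → Tendsto (fun k => a k * L k) atTop atTop →
    (∀ k S v s, 0 ≤ E k S v s ∧ E k S v s ≤ 1) →
    (∀ k S s (v w : Literature.Probability.LatticeModels.Site 4), ‖v‖ ≤ ‖w‖ → E k S w s ≤ E k S v s) →
    AbsInputRepaired a β L E → AbsDecay a L E

/-- `log 2 ≥ 1/2` (from Mathlib's decimal bound). -/
theorem half_le_log_two : (1 / 2 : ℝ) ≤ Real.log 2 := by
  have := Real.log_two_gt_d9
  linarith

/-- LOAD-BEARING (inside the shell): `¬ AbstractFMClosureRepaired`. Witness `a_k = 2^{-k}`,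
`β ≡ 0`, `L_k = 4^k`, `E_k(v) = 1/2` if `‖v‖ ≤ k 2^k` and `0` beyond: the repaired input holds at
the log-scale shell `ℓ₀ = k 2^k + 1` (`ℓ₀ a_k ≤ k + 1 ≤ 2 (1 + k log 2)`) with `E = 0` there, yet at
`v = (k2^k, …, k2^k)` the typed decay demands `1/2 ≤ C e^{-δ k}`. -/
theorem not_abstractFMClosureRepaired : ¬ AbstractFMClosureRepaired := by
  intro h
  -- the witness data
  set a : ℕ → ℝ := fun k => (1 / 2 : ℝ) ^ k with ha_def
  set L : ℕ → ℕ := fun k => 4 ^ k with hL_def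
  set E : ℕ → ℕ → Literature.Probability.LatticeModels.Site 4 → ℝ → ℝ :=
    fun k _ v _ => if ‖v‖ ≤ ((k * 2 ^ k : ℕ) : ℝ) then 1 / 2 else 0 with hE_def
  have ha_pos : ∀ k, 0 < a k := fun k => by rw [ha_def]; positivity
  have ha_lim : Tendsto a atTop (𝓝 0) :=
    tendsto_pow_atTop_nhds_zero_of_lt_one (by norm_num) (by norm_num)
  have haL : Tendsto (fun k => a k * L k) atTop atTop := by
    have : (fun k => a k * L k) = fun k => (2 : ℝ) ^ k := by
      funext k
      simp only [ha_def, hL_def]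
      push_cast
      rw [← mul_pow]; norm_num
    rw [this]
    exact tendsto_pow_atTop_atTop_of_one_lt one_lt_two
  have hE : ∀ k S v s, 0 ≤ E k S v s ∧ E k S v s ≤ 1 := by
    intro k S v s; simp only [hE_def]; split_ifs <;> norm_num
  have hmono : ∀ k S s (v w : Literature.Probability.LatticeModels.Site 4),
      ‖v‖ ≤ ‖w‖ → E k S w s ≤ E k S v s := by
    intro k S s v w hvw
    simp only [hE_def]
    split_ifs with h1 h2 h2 <;> first | (exfalso; exact h2 (hvw.trans h1)) | norm_num
  have hin : AbsInputRepaired a (fun _ => 0) L E := by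
    intro q
    refine ⟨2, 1 / 2, by norm_num, by norm_num, ?_⟩
    filter_upwards [eventually_ge_atTop 1] with k hk
    have h2k : k < 2 ^ k := Nat.lt_two_pow_self
    refine ⟨k * 2 ^ k + 1, ?_, ?_, ?_, ?_⟩
    · have : 1 ≤ k * 2 ^ k := Nat.one_le_iff_ne_zero.2 (by positivity)
      omega
    · -- k 2^k + 1 ≤ 4^k
      simp only [hL_def]
      have h4 : 4 ^ k = 2 ^ k * 2 ^ k := by rw [← mul_pow]; norm_num
      rw [h4]
      have : k + 1 ≤ 2 ^ k := h2k
      nlinarith [Nat.one_le_two_pow (n := k)]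
    · -- ℓ₀ a_k ≤ 2 (1 + |log a_k|)
      simp only [ha_def]
      have hlog : |Real.log ((1 / 2 : ℝ) ^ k)| = k * Real.log 2 := by
        rw [Real.log_pow, one_div, Real.log_inv, mul_neg, abs_neg, abs_of_nonneg]
        exact mul_nonneg (Nat.cast_nonneg k) (Real.log_nonneg one_le_two)
      rw [hlog]
      have hpow : ((k * 2 ^ k + 1 : ℕ) : ℝ) * (1 / 2 : ℝ) ^ k = k + (1 / 2 : ℝ) ^ k := by
        push_cast
        have : (2 : ℝ) ^ k * (1 / 2) ^ k = 1 := by rw [← mul_pow]; norm_num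
        linear_combination (k : ℝ) * this
      rw [hpow]
      have h1 : (1 / 2 : ℝ) ^ k ≤ 1 := pow_le_one₀ (by norm_num) (by norm_num)
      nlinarith [half_le_log_two, (Nat.cast_nonneg k : (0 : ℝ) ≤ k)]
    · intro S _ v _ hnorm
      simp only [hE_def]
      rw [if_neg]
      · simp
      · rw [hnorm]; push_cast; linarith
  obtain ⟨s, δ, C, _, _, hδ, hev⟩ := h a (fun _ => 0) L E ha_pos ha_lim haL hE hmono hin
  obtain ⟨K₁, hK₁⟩ := exists_nat_gt (2 * |C| / δ)
  obtain ⟨k, hk, hkK⟩ := (hev.and (eventually_ge_atTop K₁)).exists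
  have hkC : 2 * |C| / δ < k := hK₁.trans_le (by exact_mod_cast hkK)
  -- test point: v = (k 2^k, …, k 2^k), volume S = L k = 4^k
  have h2k : k < 2 ^ k := Nat.lt_two_pow_self
  have hnS : k * 2 ^ k ≤ 4 ^ k := by
    have h4 : 4 ^ k = 2 ^ k * 2 ^ k := by rw [← mul_pow]; norm_num
    rw [h4]; exact Nat.mul_le_mul_right _ h2k.le
  have hv : (fun _ : Fin 4 => ((k * 2 ^ k : ℕ) : ℤ)) ∈ box 4 (4 ^ k) := by
    rw [mem_box]; intro i; constructor
    · have : (0 : ℤ) ≤ ((k * 2 ^ k : ℕ) : ℤ) := by positivity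
      have h' : (0 : ℤ) ≤ ((4 ^ k : ℕ) : ℤ) := by positivity
      linarith
    · exact_mod_cast hnS
  have key := hk (4 ^ k) le_rfl (fun _ => ((k * 2 ^ k : ℕ) : ℤ)) hv
  rw [norm_constSite] at key
  simp only [hE_def] at key
  rw [norm_constSite, if_pos le_rfl] at key
  -- key : 1/2 ≤ C * exp (-(δ * (a k * (k 2^k))))
  have hak : a k * ((k * 2 ^ k : ℕ) : ℝ) = k := by
    simp only [ha_def]; push_cast
    have : (1 / 2 : ℝ) ^ k * (2 : ℝ) ^ k = 1 := by rw [← mul_pow]; norm_num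
    linear_combination (k : ℝ) * this
  rw [hak] at key
  have hkpos : (0 : ℝ) < k := lt_of_le_of_lt (by positivity) hkC
  have hexp : Real.exp (-(δ * k)) ≤ 1 / (1 + δ * k) := by
    have h1X : (0 : ℝ) < 1 + δ * k := by positivity
    have h2X : 1 + δ * k ≤ Real.exp (δ * k) := by linarith [Real.add_one_le_exp (δ * k)]
    rw [Real.exp_neg, ← one_div]
    exact one_div_le_one_div_of_le h1X h2X
  have hC : C * Real.exp (-(δ * k)) ≤ |C| * (1 / (1 + δ * k)) :=
    (le_abs_self _).trans (by
      rw [abs_mul, abs_of_pos (Real.exp_pos _)]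
      exact mul_le_mul_of_nonneg_left hexp (abs_nonneg C))
  have hX : 2 * |C| < δ * k := by
    have h' := hkC
    rw [div_lt_iff₀ hδ] at h'
    linarith
  have hlt : |C| * (1 / (1 + δ * k)) < 1 / 2 := by
    rw [mul_one_div, div_lt_iff₀ (by positivity)]
    linarith
  have : (1 / 2 : ℝ) ≤ C * Real.exp (-(δ * k)) := key
  linarith


/-! ## §6 What DOES suffice abstractly: the outward bootstrap, certified

The positive counterpart of §4–§5 (bookkeeping of Aizenman–Schenker–Friedrich–Hundertmark,
CMP 224 (2001), proof of Thm 1 / Thm 11, arXiv:math-ph/9910022 p. 8 and p. 12: a one-step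
subharmonicity bound `f(x) ≤ b · sup_{sphere of radius ℓ+1 about x} f` iterates to
`f(x) ≤ A b^n` for `‖x‖ ≥ n(ℓ+1)`). For the crux this pins the division of labour: the one-scale
input supplies the smallness of `f = pqMoment` on ONE sup-sphere (radius `ℓ₀ = ℓ + 1`); the planner's
foreseen AprioriBound + DecouplingLemma must supply (i) `A = A_k` polynomial in `β_k` and in a LOCAL
window count (not K1's global `n_w ∝ S⁴`, rattack A7), and (ii) the step with a weight `b_k` built
from FULL-torus moments on that single sphere — ASFH's own step (Thm 11, eq. powerlaw2) consumes the
annulus `L/2 ≤ ‖y‖ ≤ L`, and its box-to-full transfer (p. 13, eq. tiddledo2) costs one extra shell, so a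
one-step Harnack transfer `E(shell ℓ₀ ± 1) ≤ poly · E(shell ℓ₀)` is part of what the decoupling lemma
has to deliver here. The output is decay OUTSIDE the sphere only (§5). -/

/-- ABSTRACT OUTWARD BOOTSTRAP on `ℤ⁴` (sup norm). If `f ≤ A` everywhere and, at every `x` with
`ℓ + 1 ≤ ‖x‖`, `f x ≤ b · c` for every common bound `c` of `f` on the sup-sphere of radius `ℓ + 1`
about `x`, then `f x ≤ A bⁿ` whenever `n (ℓ + 1) ≤ ‖x‖`. -/
theorem outward_bootstrap (f : Literature.Probability.LatticeModels.Site 4 → ℝ) (A b : ℝ) (ℓ : ℕ)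
    (hA : ∀ x, f x ≤ A)
    (hstep : ∀ x : Literature.Probability.LatticeModels.Site 4, (ℓ : ℝ) + 1 ≤ ‖x‖ →
      ∀ c : ℝ, (∀ u : Literature.Probability.LatticeModels.Site 4, ‖u - x‖ = (ℓ : ℝ) + 1 → f u ≤ c) →
        f x ≤ b * c) :
    ∀ (n : ℕ) (x : Literature.Probability.LatticeModels.Site 4),
      (n : ℝ) * ((ℓ : ℝ) + 1) ≤ ‖x‖ → f x ≤ A * b ^ n := by
  intro n
  induction n with
  | zero => intro x _; simpa using hA x
  | succ n ih =>
    intro x hx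
    have hℓ : (ℓ : ℝ) + 1 ≤ ‖x‖ := by
      have h0 : (0 : ℝ) ≤ n * ((ℓ : ℝ) + 1) := by positivity
      push_cast at hx
      nlinarith
    have key := hstep x hℓ (A * b ^ n) fun u hu => ih u (by
      have h1 : ‖x‖ - ‖u‖ ≤ ‖x - u‖ := norm_sub_norm_le x u
      have h2 : ‖x - u‖ = (ℓ : ℝ) + 1 := by rw [← norm_neg, neg_sub]; exact hu
      push_cast at hx
      nlinarith)
    calc f x ≤ b * (A * b ^ n) := key
      _ = A * b ^ (n + 1) := by ring

/-- Monotonicity of the bootstrap output in the number of steps (`0 ≤ b ≤ 1`, `0 ≤ A`). In the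
crux's scales (`ℓ + 1 = ℓ₀ ≈ K₀|log a_k|/a_k`, `b = b_k ≤ (ℓ₀(1+|β_k|))^{-q} · poly`) the bound
`A bⁿ` on `‖x‖ ≥ n ℓ₀` is decay at the physical rate `≈ (q'/K₀) a_k` with the `k`-uniform prefactor
`A` — for `‖x‖ ≥ ℓ₀` only. -/
theorem outward_bootstrap_antitone (A b : ℝ) (hA : 0 ≤ A) (hb0 : 0 ≤ b) (hb1 : b ≤ 1) :
    Antitone fun n : ℕ => A * b ^ n := by
  intro m n hmn
  exact mul_le_mul_of_nonneg_left (pow_le_pow_of_le_one hb0 hb1 hmn) hA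


/-! ## §7 Numbers behind the soft corner (cycle 1; pure-python, seat folder `num/`)

Conventions: tree `wilsonDirac` at `r = 1`, free field `D(p) = M + Σ_ν(1 - cos p_ν) + i Σ_ν γ_ν sin p_ν`,
chiral basis of `euclideanGamma` (`γ_k = σʸ ⊗ σ^k`, `γ₃ = σˣ ⊗ 1`; every `γ_μ` has exactly four
off-diagonal unit entries; `γ₅ = diag(1,1,-1,-1)` checked). `X(v) := Σ_{a,i,b,j} |G(0,v)_{(a i),(b j)}|`
is the crux's colour–spin entry sum.

1. CRITERION. For `X > 0` a.s., `s ↦ E[X^s]` is log-convex with value `1` at `s = 0`, hence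
   `(∃ s ∈ (0,1), E[X^s] ≤ 1) ⇔ E[log X] < 0`: the `NNCriterion` hypothesis at a site `v` is exactly
   "geometric mean of `X(v)` below `1`".
2. HAAR `SU(3)` (N = 3·10⁵ ×2 seeds, Gram–Schmidt sampler validated by `E Σ|g_ab| = 9·8/15 = 4.8`):
   `E Σ_{ab}|g_{ab}| = 4.800`, `E log Σ_{ab}|g_{ab}| = 1.5675 ± 0.0001`, geometric mean `4.7945`,
   sample range `[3.21, 5.20]` (deterministic range `[3, 3√3]`). Random-gauge threshold for a
   colour-trivial block `A ⊗ w`, `w` Haar: `E log X < 0 ⇔ Σ_{ij}|A_{ij}| < 1/4.7945 = 0.20857`.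
3. FREE MASSLESS WILSON n.n. BLOCK (infinite volume; shifted grids `p = 2π(n+½)/L`, L = 8…20,
   converged to 5 digits at L = 16): `G(0, ±e_μ) = α·1 ∓ β·γ_μ` (up to phases) with
   `α = 0.022521`, `β = 0.037839`; entry sum `4(|α|+|β|) = 0.24144`, Frobenius `0.08807`;
   next site type `(1,1,0,0)`: entry sum `0.0679`; `G(0,0)` entry sum `≈ 0.96` (irrelevant, `v = 0`).
4. MARGIN. Near-free regime (fermion-induced ordering, `N_f → ∞` at `β = 0`, `M_k → M_c`):
   geometric mean of `X(±e_μ)` = `0.24144 × 4.7945 = 1.1576 > 1`, `E log X = +0.146`: the NN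
   hypothesis FAILS at the 8 axis neighbours (holds at the other 72: `0.0679 × 4.79 = 0.33`).
   Strong coupling, leading hopping order `G(0,e_μ) ≈ (2κ)² P₋^μ U`: `X ≈ (2κ)²·4·4.79 = 4.80`
   (`κ = 1/4 = κ_c(β=0)` mean-field), `3.07` (`κ = 0.2`), `1.20` (`κ = 1/8`, vs the exact free `1.158`);
   tadpole/mean-field interpolation `G ≈ G_free/u₀`, `u₀ < 1`, approaches the free value from ABOVE.
   Finite-volume check (full 80-site shell on L = 7, `num/corner_pure.py`): axis entry sum `0.27`
   (M = 0.05), `0.21` (M = -0.05), `0.30` (M = -1), `0.50` (M = -1.95); shell minimum `≈ 0.05`.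
5. BASIS LUCK. In a basis with `γ_μ` diagonal the same block has entry sum
   `2|α+β| + 2|α-β| = 0.15136 < 0.20857` (geometric mean `0.726`): there the corner would be
   populated and `Core` false on paper (input at `ℓ₀ = 1` true for small `s`, decay false for
   `M_k - M_c ~ a_k²`). The crux as typed survives its only soft corner by a 16% margin fixed by
   `euclideanGamma`'s representation and the entrywise ℓ¹ norm — hence the recommended repair
   `2 ≤ ℓ₀`, under which nothing depends on the basis.
-/


/-! ## §8 NON-VACUITY: the one-scale input is satisfiable — through the unit shell

The hypotheses of `Core` are satisfiable in the tree's own objects: the heavy strong-coupling sea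
`reg₀` (`β ≡ 0`, `m_crit ≡ 250`, `Z_m ≡ 1`, `a_k = 1/(k+1)`, `L_k = (k+1)²`) with `m ≡ 1` satisfies
`OneScaleInput` — and it does so with the witness `ℓ₀ = 1`, `K₀ = 1` for EVERY `q` (§4's corner is
inhabited by honest regularisations). Mechanism: a max-principle entry bound for diagonally dominant
inverses (`norm_inv_entry_le_of_rowsum`: if the off-diagonal part of `c•1 - A` has row sums `≤ κ < c`
then `‖A⁻¹ i j‖ ≤ 1/(c-κ)`), the crude row-sum bound `96` for the Wilson hopping matrix (entries of
`1 ∓ γ_μ` have norm `≤ 2`, entries of `SU(3)` matrices `≤ 1`, 12 colour–spin neighbours per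
direction and orientation), hence `X(U,v) = Σ_{a i b j}|G| ≤ 144/158 < 1` configuration-wise, and
`E_{|w|}[X^s] ≤ 1` by monotonicity of the Bochner integral against the `|det|` weight
(`integrable_norm_det_diracMatrix`, `isProbabilityMeasure_wilsonMeasure_fundamental` of
`QCDPhaseQuenched.lean`). Consequently `Core` is not vacuously true, and (given K1 ∧ K3) the crux
asserts physical-rate decay for this sea — true, but note it is CLAIMED from an `O(1)` unit-shell input. -/

section NonVacuity

open Matrix

/-- MAX-PRINCIPLE ENTRY BOUND for diagonally dominant inverses: if `K := c•1 - A` has row sums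
`Σ_j ‖K i j‖ ≤ κ < c`, then every entry of `A⁻¹` (Mathlib's total `Matrix.inv`) has norm
`≤ 1/(c - κ)`. -/
theorem norm_inv_entry_le_of_rowsum {ι : Type*} [Fintype ι] [DecidableEq ι] (A : Matrix ι ι ℂ)
    (c κ : ℝ) (hrow : ∀ i, ∑ j, ‖(((c : ℂ)) • (1 : Matrix ι ι ℂ) - A) i j‖ ≤ κ) (hκ : κ < c)
    (i j : ι) : ‖A⁻¹ i j‖ ≤ 1 / (c - κ) := by
  have hκ0 : 0 ≤ κ := (Finset.sum_nonneg fun j _ => norm_nonneg _).trans (hrow i)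
  have hc : 0 < c := hκ0.trans_lt hκ
  have hcκ : 0 < c - κ := sub_pos.2 hκ
  by_cases hA : IsUnit A.det
  · set B := A⁻¹ with hB
    have hmul : A * B = 1 := A.mul_nonsing_inv hA
    obtain ⟨i₀, -, hi₀⟩ :=
      Finset.exists_max_image Finset.univ (fun l => ‖B l j‖) ⟨i, Finset.mem_univ i⟩
    set m := ‖B i₀ j‖ with hm
    have key : ((((c : ℂ)) • (1 : Matrix ι ι ℂ) - A) * B) i₀ j =
        (c : ℂ) * B i₀ j - (1 : Matrix ι ι ℂ) i₀ j := by
      rw [sub_mul, Matrix.smul_mul, Matrix.one_mul, hmul, Matrix.sub_apply, Matrix.smul_apply,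
        smul_eq_mul]
    rw [Matrix.mul_apply] at key
    -- norm estimate at the maximiser
    have h1 : ‖(1 : Matrix ι ι ℂ) i₀ j‖ ≤ 1 := by
      rw [Matrix.one_apply]; split_ifs <;> simp
    have hsum : ‖∑ l, (((c : ℂ)) • (1 : Matrix ι ι ℂ) - A) i₀ l * B l j‖ ≤ κ * m := by
      calc ‖∑ l, (((c : ℂ)) • (1 : Matrix ι ι ℂ) - A) i₀ l * B l j‖
          ≤ ∑ l, ‖(((c : ℂ)) • (1 : Matrix ι ι ℂ) - A) i₀ l * B l j‖ := norm_sum_le _ _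
        _ ≤ ∑ l, ‖(((c : ℂ)) • (1 : Matrix ι ι ℂ) - A) i₀ l‖ * m := by
            refine Finset.sum_le_sum fun l _ => ?_
            rw [norm_mul]
            exact mul_le_mul_of_nonneg_left (hi₀ l (Finset.mem_univ l)) (norm_nonneg _)
        _ = (∑ l, ‖(((c : ℂ)) • (1 : Matrix ι ι ℂ) - A) i₀ l‖) * m := (Finset.sum_mul _ _ _).symm
        _ ≤ κ * m := mul_le_mul_of_nonneg_right (hrow i₀) (norm_nonneg _)
    have hcm : c * m ≤ 1 + κ * m := by
      have : (c : ℂ) * B i₀ j = (1 : Matrix ι ι ℂ) i₀ j +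
          ∑ l, (((c : ℂ)) • (1 : Matrix ι ι ℂ) - A) i₀ l * B l j := by
        rw [key]; ring
      have hn : ‖(c : ℂ) * B i₀ j‖ = c * m := by
        rw [norm_mul, Complex.norm_real, Real.norm_eq_abs, abs_of_pos hc]
      rw [← hn, this]
      exact (norm_add_le _ _).trans (add_le_add h1 hsum)
    have hmle : m ≤ 1 / (c - κ) := by
      rw [le_div_iff₀ hcκ]; nlinarith
    exact (hi₀ i (Finset.mem_univ i)).trans hmle
  · rw [Matrix.nonsing_inv_apply_not_isUnit _ hA]
    simp only [Matrix.zero_apply, norm_zero]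
    positivity

variable {L : ℕ} [NeZero L]

/-- The Wilson hopping matrix (the off-diagonal part of the tree's `wilsonDirac` at `r = 1`). -/
def hop (U : GaugeConfig 4 L 𝔾) (p q : TorusSite 4 L × Fin 3 × Fin 4) : ℂ :=
  (1 / 2 : ℂ) * ∑ μ : Fin 4,
    ((if q.1 = Literature.MathematicalPhysics.QuantumFieldTheory.Site.shift p.1 μ then
        (((1 : ℝ) : ℂ) • (1 : Matrix (Fin 4) (Fin 4) ℂ) - euclideanGamma μ) p.2.2 q.2.2 *
          fundamentalRep (Fin 3) (U (p.1, μ)) p.2.1 q.2.1 else 0) +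
      (if p.1 = Literature.MathematicalPhysics.QuantumFieldTheory.Site.shift q.1 μ then
        (((1 : ℝ) : ℂ) • (1 : Matrix (Fin 4) (Fin 4) ℂ) + euclideanGamma μ) p.2.2 q.2.2 *
          fundamentalRep (Fin 3) (U (q.1, μ))⁻¹ p.2.1 q.2.1 else 0))

omit [NeZero L] in
/-- `D_W(U, M, 1) = (M+4)•1 - hop` entrywise. -/
theorem wilsonDirac_apply_eq (U : GaugeConfig 4 L 𝔾) (M : ℝ) (p q : TorusSite 4 L × Fin 3 × Fin 4) :
    wilsonDirac (fundamentalRep (Fin 3)) U M 1 p q =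
      (((M + 4 : ℝ) : ℂ)) * (1 : Matrix _ _ ℂ) p q - hop U p q := by
  simp only [wilsonDirac, hop, Matrix.of_apply, Matrix.one_apply, mul_one, mul_ite, mul_zero]

/-- Entries of the Euclidean gamma matrices have norm at most `1` (they are unitary). -/
theorem norm_euclideanGamma_apply_le (μ : Fin 4) (α β : Fin 4) : ‖euclideanGamma μ α β‖ ≤ 1 := by
  have hmem : euclideanGamma μ ∈ Matrix.unitaryGroup (Fin 4) ℂ := by
    rw [Matrix.mem_unitaryGroup_iff']
    rw [Matrix.star_eq_conjTranspose, (euclideanGamma_isHermitian μ).eq]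
    exact euclideanGamma_mul_self μ
  exact entry_norm_bound_of_unitary hmem α β

/-- Entries of `1 ∓ γ_μ` have norm at most `2`. -/
theorem norm_one_sub_gamma_apply_le (μ α β : Fin 4) :
    ‖(((1 : ℝ) : ℂ) • (1 : Matrix (Fin 4) (Fin 4) ℂ) - euclideanGamma μ) α β‖ ≤ 2 := by
  rw [Matrix.sub_apply, Matrix.smul_apply, Complex.ofReal_one, one_smul]
  refine (norm_sub_le _ _).trans ?_
  have h1 : ‖(1 : Matrix (Fin 4) (Fin 4) ℂ) α β‖ ≤ 1 := by
    rw [Matrix.one_apply]; split_ifs <;> simp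
  linarith [norm_euclideanGamma_apply_le μ α β]

theorem norm_one_add_gamma_apply_le (μ α β : Fin 4) :
    ‖(((1 : ℝ) : ℂ) • (1 : Matrix (Fin 4) (Fin 4) ℂ) + euclideanGamma μ) α β‖ ≤ 2 := by
  rw [Matrix.add_apply, Matrix.smul_apply, Complex.ofReal_one, one_smul]
  refine (norm_add_le _ _).trans ?_
  have h1 : ‖(1 : Matrix (Fin 4) (Fin 4) ℂ) α β‖ ≤ 1 := by
    rw [Matrix.one_apply]; split_ifs <;> simp
  linarith [norm_euclideanGamma_apply_le μ α β]

/-- Entries of a fundamental `SU(3)` matrix have norm at most `1`. -/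
theorem norm_fundamentalRep_apply_le (g : 𝔾) (a b : Fin 3) : ‖fundamentalRep (Fin 3) g a b‖ ≤ 1 :=
  entry_norm_bound_of_unitary (fundamentalRep_mem_unitaryGroup g) a b

/-- Counting colour–spin neighbours: `Σ_{q : sites × colour × spin} [q.site = s] = 12`. -/
theorem sum_ite_site_eq (s : TorusSite 4 L) (c : ℝ) :
    ∑ q : TorusSite 4 L × Fin 3 × Fin 4, (if q.1 = s then c else 0) = 12 * c := by
  rw [Fintype.sum_prod_type]
  have hin : ∀ x : TorusSite 4 L,
      (∑ _y : Fin 3 × Fin 4, (if x = s then c else 0)) = if x = s then 12 * c else 0 := by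
    intro x
    rw [Finset.sum_const, Finset.card_univ, Fintype.card_prod, Fintype.card_fin, Fintype.card_fin,
      nsmul_eq_mul]
    split_ifs <;> norm_num
  simp_rw [hin]
  rw [Finset.sum_ite_eq' Finset.univ s, if_pos (Finset.mem_univ s)]

/-- ROW SUMS OF THE WILSON HOPPING MATRIX are at most `96` (crude: `½ · 4 directions · 2
orientations · 12 neighbours · 2 · 1`). -/
theorem hop_rowsum_le (U : GaugeConfig 4 L 𝔾) (p : TorusSite 4 L × Fin 3 × Fin 4) :
    ∑ q, ‖hop U p q‖ ≤ 96 := by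
  -- termwise bound
  have hF : ∀ (μ : Fin 4) (q : TorusSite 4 L × Fin 3 × Fin 4),
      ‖(if q.1 = Literature.MathematicalPhysics.QuantumFieldTheory.Site.shift p.1 μ then
        (((1 : ℝ) : ℂ) • (1 : Matrix (Fin 4) (Fin 4) ℂ) - euclideanGamma μ) p.2.2 q.2.2 *
          fundamentalRep (Fin 3) (U (p.1, μ)) p.2.1 q.2.1 else 0)‖ ≤
        if q.1 = Literature.MathematicalPhysics.QuantumFieldTheory.Site.shift p.1 μ then (2 : ℝ) else 0 := by
    intro μ q
    split_ifs with h
    · rw [norm_mul]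
      have := norm_one_sub_gamma_apply_le μ p.2.2 q.2.2
      have := norm_fundamentalRep_apply_le (U (p.1, μ)) p.2.1 q.2.1
      nlinarith [norm_nonneg ((((1 : ℝ) : ℂ) • (1 : Matrix (Fin 4) (Fin 4) ℂ) - euclideanGamma μ) p.2.2 q.2.2),
        norm_nonneg (fundamentalRep (Fin 3) (U (p.1, μ)) p.2.1 q.2.1)]
    · simp
  have hB : ∀ (μ : Fin 4) (q : TorusSite 4 L × Fin 3 × Fin 4),
      ‖(if p.1 = Literature.MathematicalPhysics.QuantumFieldTheory.Site.shift q.1 μ then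
        (((1 : ℝ) : ℂ) • (1 : Matrix (Fin 4) (Fin 4) ℂ) + euclideanGamma μ) p.2.2 q.2.2 *
          fundamentalRep (Fin 3) (U (q.1, μ))⁻¹ p.2.1 q.2.1 else 0)‖ ≤
        if q.1 = p.1 - Pi.single μ 1 then (2 : ℝ) else 0 := by
    intro μ q
    have hiff : p.1 = Literature.MathematicalPhysics.QuantumFieldTheory.Site.shift q.1 μ ↔ q.1 = p.1 - Pi.single μ 1 := by
      rw [Literature.MathematicalPhysics.QuantumFieldTheory.Site.shift, eq_sub_iff_add_eq, eq_comm]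
    by_cases h : p.1 = Literature.MathematicalPhysics.QuantumFieldTheory.Site.shift q.1 μ
    · rw [if_pos h, if_pos (hiff.1 h), norm_mul]
      have := norm_one_add_gamma_apply_le μ p.2.2 q.2.2
      have := norm_fundamentalRep_apply_le (U (q.1, μ))⁻¹ p.2.1 q.2.1
      nlinarith [norm_nonneg ((((1 : ℝ) : ℂ) • (1 : Matrix (Fin 4) (Fin 4) ℂ) + euclideanGamma μ) p.2.2 q.2.2),
        norm_nonneg (fundamentalRep (Fin 3) (U (q.1, μ))⁻¹ p.2.1 q.2.1)]
    · rw [if_neg h, if_neg (fun h' => h (hiff.2 h'))]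
      simp
  -- assemble
  calc ∑ q, ‖hop U p q‖
      ≤ ∑ q : TorusSite 4 L × Fin 3 × Fin 4, (1 / 2 : ℝ) * ∑ μ : Fin 4,
          ((if q.1 = Literature.MathematicalPhysics.QuantumFieldTheory.Site.shift p.1 μ then (2 : ℝ) else 0) +
            (if q.1 = p.1 - Pi.single μ 1 then (2 : ℝ) else 0)) := by
        refine Finset.sum_le_sum fun q _ => ?_
        unfold hop
        rw [norm_mul]
        have hhalf : ‖(1 / 2 : ℂ)‖ = 1 / 2 := by simp
        rw [hhalf]
        refine mul_le_mul_of_nonneg_left ((norm_sum_le _ _).trans (Finset.sum_le_sum fun μ _ =>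
          (norm_add_le _ _).trans (add_le_add (hF μ q) (hB μ q)))) (by norm_num)
    _ = (1 / 2 : ℝ) * ∑ μ : Fin 4, ((∑ q : TorusSite 4 L × Fin 3 × Fin 4,
          (if q.1 = Literature.MathematicalPhysics.QuantumFieldTheory.Site.shift p.1 μ then (2 : ℝ) else 0)) +
          ∑ q : TorusSite 4 L × Fin 3 × Fin 4, (if q.1 = p.1 - Pi.single μ 1 then (2 : ℝ) else 0)) := by
        rw [← Finset.mul_sum, Finset.sum_comm]
        simp only [Finset.sum_add_distrib]
    _ = 96 := by
        simp only [sum_ite_site_eq]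
        norm_num

/-- The un-reindexed one-flavour Wilson–Dirac matrix. -/
def dirac₁ (U : GaugeConfig 4 L 𝔾) (M : ℝ) : Matrix (QuarkVar 1 L) (QuarkVar 1 L) ℂ :=
  Matrix.of fun v w => if v.1 = w.1 then wilsonDirac (fundamentalRep (Fin 3)) U M 1 v.2 w.2 else 0

theorem diracMatrix_one_flavour (U : GaugeConfig 4 L 𝔾) (mq : Fin 1 → ℝ) :
    diracMatrix U mq = Matrix.reindex quarkEquiv quarkEquiv (dirac₁ U (mq 0)) := by
  have hmq : ∀ f : Fin 1, mq f = mq 0 := fun f => by rw [Subsingleton.elim f 0]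
  unfold diracMatrix dirac₁
  congr 1
  ext v w
  simp only [Matrix.of_apply, hmq v.1]

theorem inv_diracMatrix_apply (U : GaugeConfig 4 L 𝔾) (mq : Fin 1 → ℝ) (p q : QuarkVar 1 L) :
    (diracMatrix U mq)⁻¹ (quarkEquiv p) (quarkEquiv q) = (dirac₁ U (mq 0))⁻¹ p q := by
  rw [diracMatrix_one_flavour, Matrix.inv_reindex, Matrix.reindex_apply, Matrix.submatrix_apply,
    Equiv.symm_apply_apply, Equiv.symm_apply_apply]

omit [NeZero L] in
/-- The off-diagonal part of `(M+4)•1 - dirac₁` is the hopping matrix. -/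
theorem smul_one_sub_dirac₁_apply (U : GaugeConfig 4 L 𝔾) (M : ℝ) (v w : QuarkVar 1 L) :
    ((((M + 4 : ℝ) : ℂ)) • (1 : Matrix (QuarkVar 1 L) (QuarkVar 1 L) ℂ) - dirac₁ U M) v w =
      hop U v.2 w.2 := by
  have h1 : v.1 = w.1 := Subsingleton.elim _ _
  have hvw : v = w ↔ v.2 = w.2 := by
    constructor
    · rintro rfl; rfl
    · intro h; exact Prod.ext h1 h
  simp only [dirac₁, Matrix.sub_apply, Matrix.smul_apply, Matrix.of_apply, if_pos h1,
    wilsonDirac_apply_eq, Matrix.one_apply, smul_eq_mul, hvw]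
  split_ifs <;> ring

theorem rowsum_dirac₁_le (U : GaugeConfig 4 L 𝔾) (M : ℝ) (v : QuarkVar 1 L) :
    ∑ w, ‖((((M + 4 : ℝ) : ℂ)) • (1 : Matrix (QuarkVar 1 L) (QuarkVar 1 L) ℂ) - dirac₁ U M) v w‖ ≤ 96 := by
  simp only [smul_one_sub_dirac₁_apply]
  rw [Fintype.sum_prod_type, Fin.sum_univ_one]
  exact hop_rowsum_le U v.2

/-- ENTRY BOUND for the heavy one-flavour propagator: bare mass `M ≥ 250` gives
`|G_{(x a i),(y b j)}| ≤ 1/158` for every configuration. -/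
theorem norm_inv_diracMatrix_apply_le (U : GaugeConfig 4 L 𝔾) (mq : Fin 1 → ℝ) (hM : 250 ≤ mq 0)
    (p q : QuarkVar 1 L) : ‖(diracMatrix U mq)⁻¹ (quarkEquiv p) (quarkEquiv q)‖ ≤ 1 / 158 := by
  rw [inv_diracMatrix_apply]
  have h := norm_inv_entry_le_of_rowsum (dirac₁ U (mq 0)) (mq 0 + 4) 96
    (rowsum_dirac₁_le U (mq 0)) (by linarith) p q
  refine h.trans ?_
  rw [div_le_div_iff_of_pos_left one_pos (by linarith) (by norm_num)]
  linarith

/-- CONFIGURATION-WISE SMALLNESS of the colour–spin entry sum: `X(U, v) ≤ 144/158 < 1`. -/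
theorem entrySum_le (U : GaugeConfig 4 L 𝔾) (mq : Fin 1 → ℝ) (hM : 250 ≤ mq 0) (f : Fin 1)
    (x y : TorusSite 4 L) :
    (∑ a : Fin 3, ∑ i : Fin 4, ∑ b : Fin 3, ∑ j : Fin 4,
      ‖(diracMatrix U mq)⁻¹ (quarkEquiv (f, (x, a, i))) (quarkEquiv (f, (y, b, j)))‖) ≤ 144 / 158 := by
  calc (∑ a : Fin 3, ∑ i : Fin 4, ∑ b : Fin 3, ∑ j : Fin 4,
      ‖(diracMatrix U mq)⁻¹ (quarkEquiv (f, (x, a, i))) (quarkEquiv (f, (y, b, j)))‖)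
      ≤ ∑ _a : Fin 3, ∑ _i : Fin 4, ∑ _b : Fin 3, ∑ _j : Fin 4, (1 / 158 : ℝ) := by
        gcongr with a _ i _ b _ j _
        exact norm_inv_diracMatrix_apply_le U mq hM _ _
    _ = 144 / 158 := by simp; norm_num

/-- THE HEAVY STRONG-COUPLING SEA: `β ≡ 0`, `m_crit ≡ 250`, `Z_m ≡ 1`, `a_k = 1/(k+1)`,
`L_k = (k+1)²`. -/
def reg₀ : QCDRegularisation 1 where
  a := fun k => 1 / ((k : ℝ) + 1)
  a_pos := fun k => by positivity
  tendsto_a := tendsto_one_div_add_atTop_nhds_zero_nat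
  β := fun _ => 0
  L := fun k => (k + 1) ^ 2
  tendsto_L := by
    have : (fun k : ℕ => (1 : ℝ) / ((k : ℝ) + 1) * (((k + 1) ^ 2 : ℕ) : ℝ)) = fun k : ℕ => (k : ℝ) + 1 := by
      funext k
      push_cast
      have : (k : ℝ) + 1 ≠ 0 := by positivity
      field_simp
    rw [this]
    exact tendsto_atTop_add_const_right _ 1 tendsto_natCast_atTop_atTop
  mcrit := fun _ => 250
  Zm := fun _ => 1
  Zm_pos := fun _ => one_pos

/-- On the heavy sea every phase-quenched fractional moment of the entry sum is at most `1`. -/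
theorem pqMoment_reg₀_le_one (k S : ℕ) (f : Fin 1) (v : Literature.Probability.LatticeModels.Site 4)
    {s : ℝ} (hs : 0 ≤ s) : pqMoment reg₀ (fun _ => 1) k S f v s ≤ 1 := by
  unfold pqMoment
  set mq : Fin 1 → ℝ := fun fl => reg₀.mcrit k + reg₀.a k * (fun _ : Fin 1 => (1 : ℝ)) fl / reg₀.Zm k
    with hmq
  have hM : 250 ≤ mq 0 := by
    simp only [hmq, reg₀]
    have : (0 : ℝ) ≤ 1 / ((k : ℝ) + 1) := by positivity
    linarith [this]
  set μ := wilsonMeasure (d := 4) (L := 2 * S + 1) (fundamentalRep (Fin 3)) (reg₀.β k) with hμ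
  -- pointwise: 0 ≤ |det| X^s ≤ |det|
  have hX : ∀ U : GaugeConfig 4 (2 * S + 1) 𝔾,
      (∑ a : Fin 3, ∑ i : Fin 4, ∑ b : Fin 3, ∑ j : Fin 4,
        ‖(diracMatrix U mq)⁻¹ (quarkEquiv (f, (Torus.proj (2 * S + 1) 0, a, i)))
          (quarkEquiv (f, (Torus.proj (2 * S + 1) v, b, j)))‖) ^ s ≤ 1 := fun U =>
    Real.rpow_le_one (by positivity) ((entrySum_le U mq hM f _ _).trans (by norm_num)) hs
  have hle : ∫ U, ‖(diracMatrix U mq).det‖ *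
      (∑ a : Fin 3, ∑ i : Fin 4, ∑ b : Fin 3, ∑ j : Fin 4,
        ‖(diracMatrix U mq)⁻¹ (quarkEquiv (f, (Torus.proj (2 * S + 1) 0, a, i)))
          (quarkEquiv (f, (Torus.proj (2 * S + 1) v, b, j)))‖) ^ s ∂μ ≤
      ∫ U, ‖(diracMatrix U mq).det‖ ∂μ := by
    refine integral_mono_of_nonneg (Eventually.of_forall fun U => ?_)
      (integrable_norm_det_diracMatrix mq μ) (Eventually.of_forall fun U => ?_)
    · exact mul_nonneg (norm_nonneg _) (by positivity)
    · have := hX U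
      have h0 : 0 ≤ ‖(diracMatrix U mq).det‖ := norm_nonneg _
      calc _ ≤ ‖(diracMatrix U mq).det‖ * 1 := mul_le_mul_of_nonneg_left this h0
        _ = _ := mul_one _
  exact div_le_one_of_le₀ hle (integral_nonneg fun U => norm_nonneg _)

/-- NON-VACUITY of the crux's hypothesis, witnessed IN THE UNIT-SHELL CORNER: the heavy sea
satisfies `OneScaleInput` with `ℓ₀ = 1`, `K₀ = 1`, `s = 1/2` for every `q`. -/
theorem oneScaleInput_reg₀ : OneScaleInput reg₀ (fun _ => 1) := by
  intro q
  refine ⟨1, 1 / 2, by norm_num, by norm_num, Eventually.of_forall fun k => ⟨1, le_rfl, ?_, ?_, ?_⟩⟩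
  · show 1 ≤ (k + 1) ^ 2
    exact Nat.one_le_pow _ _ (Nat.succ_pos k)
  · show ((1 : ℕ) : ℝ) * (1 / ((k : ℝ) + 1)) ≤ 1 * (1 + |Real.log (1 / ((k : ℝ) + 1))|)
    have h0 : 0 ≤ |Real.log (1 / ((k : ℝ) + 1))| := abs_nonneg _
    have h1 : 1 / ((k : ℝ) + 1) ≤ 1 := by
      rw [div_le_one (by positivity)]
      linarith [(Nat.cast_nonneg k : (0 : ℝ) ≤ k)]
    push_cast
    nlinarith
  · intro S _ f v _ _
    have hβ : reg₀.β k = 0 := rfl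
    rw [hβ]
    simp only [Nat.cast_one, one_pow, abs_zero, add_zero, one_mul]
    exact pqMoment_reg₀_le_one k S f v (by norm_num)

/-- The hypotheses of `Core` are satisfiable (the crux is not vacuously true given its guards). -/
theorem oneScaleInput_nonvacuous :
    ∃ (reg : QCDRegularisation 1) (m : Fin 1 → ℝ), (∀ f, 0 < m f) ∧ OneScaleInput reg m :=
  ⟨reg₀, fun _ => 1, fun _ => one_pos, oneScaleInput_reg₀⟩

/-- What the crux CLAIMS on the heavy sea, from its unit-shell `O(1)` input alone: physical-rate
decay of the phase-quenched propagator moments (true here for honest reasons — configuration-wise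
Neumann decay — but not by the stated mechanism). -/
theorem decay_reg₀_of_core (h : Core) : Decay reg₀ (fun _ => 1) :=
  h 1 reg₀ _ (fun _ => one_pos) oneScaleInput_reg₀

end NonVacuity


/-! ## Targets — the picked line `thick-collar-far-stability` (lead cycle 1, skeleton of 03:23Z)

Registered stubs (signatures read from the item payload 05:0xZ; Props `TwoStarBounds`, `FarStability`,
`CollarResolventBounds`, `UnitShellLowerBound`, `HoppingDecay`, `InwardExtension`, `OutwardDecayWith`
of `Lines/thick-collar-far-stability.lean`). `stub_hopping` (p75265) and `stub_resolvent` (p77083)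
are LANDED — not attacked. For the five open ones the cheapest kills were tried; none breaks:

* `stub_unitShell : ∀ Nf, UnitShellLowerBound Nf` (∃ β₀ S₀: |β| ≤ β₀, probe mass ∈ [-8.1, 0.1],
  S ≥ S₀, every s ∈ (0,1) ⇒ some unit-shell `v` has `cruxMoment > 1`). Attacks: (i) `Nf = 0` —
  vacuous-true (no kill); (ii) denominator junk — excluded (the lead's `QCDPhaseQuenchedPositivity`,
  `0 < ∫‖det D‖dμ_W` for all data); (iii) `s → 0⁺` — consistent (Jensen: `E Y^s ≥ exp(s E log Y)`);
  (iv) LARGE `N_f` with a heavy sea (other masses free!) driving the links to pure gauge at `β = 0`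
  (fermion-induced ordering, `Δβ ∝ +N_f κ_sea⁴`): the probe then sees the free block in a Haar-random
  gauge, `E log Y(±e_μ) = log(4(|α|+|β|)(m)) + 1.5675`; at the window edge `m = 0.1` the free block is
  `0.23403` (§7 method, L = 16 shifted grid) ⇒ `E log Y = +0.115 > 0` — the infimum over all regimes I
  can reach stays positive (it would cross `0` only near `m ≈ 0.45`, inside the landed hopping window
  `|m+4| ≥ 4.1`). The two stubs tile the mass axis with a seam margin of `+0.115`: thin, TRUE-looking,
  and (as the lead says) unprovable where it matters. Not broken.
* `stub_inward : ∀ Nf reg m > 0, InwardExtension Nf reg m` (TwoStarBounds → Input → ∀ outward package,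
  ∃ inward package at the same `s`). Abstractly false (§5). Concrete attack: the heavy sea `reg₀` (§8)
  satisfies `Input` (unit shell) and — by the landed `stub_hopping` — `OutwardDecayWith` for EVERY
  admissible radius function `ℓ₀(k,f)`, including log-scale ones; but it also decays inside (lattice
  rate `log(41/40)·s` configuration-wise), so `InwardDecayWith` holds: no counterexample. A kill needs a
  regularisation with a plateau inside the log-shell and fast decay across it (non-log-convex radial
  profile) — not realisable by any sea I can control (§5 remark). Not broken; remains a PROVABILITY gap
  off the reflection-positive locus, exactly as the lead's table records.
* `stub_twoStar : K1 → K3 → ∀ Nf, TwoStarBounds Nf` and `stub_farStability : K1 → K3 → ∀ Nf,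
  FarStability Nf`. Guarded like the crux (§1): a kill must prove K1 ∧ K3. Attack on the CONSEQUENTS as
  Props (a false consequent would make `stub_closure`/`stub_inward` vacuous and turn `stub_twoStar`
  into `¬(K1 ∧ K3)` — a misstatement signal): (T5) `pqE‖G(x,y)‖^s ≤ C(1+|β|)^p` for ALL β ∈ ℝ, probe
  mass ∈ [-9,1], all other masses, all S — corner `β → -∞` (measure concentrates on maximal-action
  centre-flux backgrounds, where `D_W(·, m*)` can have exact zero modes at special `m* ∈ [-9,1]`): the
  `|det|` weight vanishes linearly there and the quotient grows like `|β|^{s/2}` — absorbed by the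
  POLYNOMIAL allowance `(1+|β|)^p`; corner `β → +∞`, `m_f = 0`, flat holonomy sector: zero-mode lifted by
  the twist, `pqE` finite, S-uniformity plausible (`1/(S³θ)`). (T0) integrability: continuous integrands
  except at `det(side) = 0` where `gside` is Mathlib's junk `0` — bounded, fine. No cheap kill; the
  real objection is the lead's point 1 (K1's extensive `(1+n_w)` cannot yield the S-uniform (T5)), a
  statement about PROVABILITY from K1, not falsity of `TwoStarBounds`.
* `stub_closure`: pure bookkeeping from the five inputs (`outward_bootstrap`, §6, is its iteration
  step; the lead's `SubharmonicIterationDecay.lean` is the landable version). Nothing to attack.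

Net: 5 targets examined, 0 broken; the line is blocked by provability (points 1–4 of LEAD-c1.md), and
the planner-level repair `K2Repaired.lean` (`2 ≤ ℓ₀`, ranges, outward-only conclusion, volume-uniform
two-star antecedent) removes §4–§5's objections by construction: `coreRepaired_of_core` shows the
`2 ≤ ℓ₀` part is free; the outward-only conclusion is exactly what §5–§6 say is derivable.
-/

end

end Summit.QuantumFields.QCD.Cruxes.FMClosureUnquenched.Disproof
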